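import Summits.BirchSwinnertonDyer.BirchSwinnertonDyer.Theses.SignedBaseChange
import Literature.NumberTheory.EllipticCurves.BurungaleCastellaSkinner2025.BDPMainConjecture
import Literature.NumberTheory.EllipticCurves.YanZhu2026.GreenbergMainTheoremsAnyRootGuarded
import Literature.NumberTheory.EllipticCurves.AnticyclotomicRankinSelbergPAdicLFunction
import Literature.NumberTheory.EllipticCurves.NonEisensteinPrimeOfSurjective
import Summits.BirchSwinnertonDyer.Rank1Residual.X11b.FrameIdealRigidity
import Summits.BirchSwinnertonDyer.Rank1Residual.X11b.HalvesReceptacle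
import Summits.BirchSwinnertonDyer.Rank1Residual.X11b.BDPRouteOpenInputDescent
import HarnessLib

/-!
# The rational anticyclotomic crux `AnticyclotomicEisensteinDivisibilityRat` (rev 16-RAT child of K1″
# `TwistPairGreenbergProductDivisibilityCanonical`, route SignedBaseChange): its ORDINARY slice BY NAME modulo the specialisation
# statement, and the first rung of the proposed line `bdpline` (lead sbc-p1 g5; helper)

Line `bdpline` (lead's proposal, HOME/bsd-wall-sbc-p1/Lines_bdpline_draft.lean / .md) splits the crux into S1 `stub_bdpLowerHalfRatExists`
(the RATIONAL Eisenstein half of the one-variable BDP anticyclotomic main conjecture at a good prime, ∃-frame — the shape of BCS25 Thm 1.2.4 (a)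
with `GoodOrd` replaced by good reduction; RESEARCH at supersingular `p` = G2″), S2 `stub_specializationRat` (rational specialisation
`T₁ ↦ 0` of `ch(X_Gr₂)` onto `ch(X_Gr(E/K_∞⁻))`, SUPPORT) and S3 `stub_minusIsBDP` (`G⁻` is a BDP `L`-function: frame existence + comparison,
SUPPORT). This file is the line's FIRST RUNG, i.e. design validation at a good ORDINARY prime, BY NAME from published named facts:
* §1 `minusIsBDP_of_goodOrd`: S3 at `GoodOrd` ⇐ `YanZhu2026.prop314_span_minus_eq_span_bdp_anyRoot_guarded` + `BurungaleCastellaSkinner2025.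
  prop422_exists_isBDPLFunction_mu_eq_zero`;
* §2 `bdpLowerHalfRatExists_of_goodOrd`: S1 at `GoodOrd` ⇐ `BurungaleCastellaSkinner2025.thm124a_…` along `X11b.Halves.toUnr : ℤ_p → R₀`,
  pushed to the structure maps `J : ℤ_p → 𝒪_{ℂ_p}`, `J₀ : R₀ → 𝒪_{ℂ_p}` of the crux (`J = J₀ ∘ toUnr` by injectivity of `𝒪_{ℂ_p} → ℂ_p`);
* §3 `acDivRatChild_of_goodOrd_of_specialization`: the crux's text (HOME/bsd-wall-ss/rev16-RAT/ChildACdivRatT.sig 59ba2ed92b373317) with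
  `GoodOrd W p` inserted, from the three named facts and S2 ALONE, through the `bdpline` composition (the two BDP frames differ by a unit:
  `X11b.R1.exists_unit_mul_eq_of_isBDPLFunctionInt` + `R1.isBDPLFunctionInt_map`).
* §4 the INTEGRAL twins for the live integral child stmt-…-20576 (`bdpLowerHalfExists_of_goodOrd` from `thm124b_…`;
  `acDivChild_of_goodOrd_of_specialization_of_torsion`: 20576's text with `GoodOrd` inserted ⇐ thm124b + prop314_guarded + prop422_exists + S2 + S0).
So at ordinary `p` the rational anticyclotomic child is print + S2; at supersingular `p` it is S1 (G2″) + S3-at-ss (BSTW §5, typing) + S2.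
Conditional on the named facts taken as hypotheses; nothing asserted; no new definitions.
-/

set_option linter.dupNamespace false
set_option autoImplicit false

noncomputable section

namespace Summit.BirchSwinnertonDyer.BirchSwinnertonDyer.Theorems.SignedBaseChangeBdplineRungs

open Summit.BirchSwinnertonDyer.BirchSwinnertonDyer.Theses.SignedBaseChange
open Literature.NumberTheory.EllipticCurves Literature.NumberTheory.EllipticCurves.YanZhu2026
  Literature.NumberTheory.EllipticCurves.BurungaleCastellaSkinner2025

/-! ## §1 S3 at a good ordinary prime -/

/-- **S3 at a good ordinary prime, by name**: the text of `stub_minusIsBDP` with `GoodOrd W p` inserted, from YZ26 Prop 3.14 (guarded; comparison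
`(G⁻) = (J₀ L)`) and BCS25 Prop 4.2.2 (existence of a BDP frame). [cite: YanZhu2024MainConjNonCM, Prop. 3.14 (arXiv:2412.20078v4)]
[cite: BurungaleCastellaSkinner2025, Prop. 4.2.2 (arXiv:2405.00270v2 pp. 8–9)] -/
theorem minusIsBDP_of_goodOrd (h314 : prop314_span_minus_eq_span_bdp_anyRoot_guarded)
    (h422e : prop422_exists_isBDPLFunction_mu_eq_zero) :
    SignedTwoVariableInputs → Literature.NumberTheory.EllipticCurves.ModularForms.nonempty_modularParametrizationData → ∀ (W : WeierstrassCurve ℚ) [W.IsElliptic] [W.IsGloballyMinimal] (p : ℕ) [Fact p.Prime], 5 ≤ p → W.HasGoodReductionAtPrime p → Literature.NumberTheory.EllipticCurves.Rank1Residual.GoodOrd W p → Literature.NumberTheory.EllipticCurves.Rank1Residual.Surj W p → ∀ (K : Type) [Field K] [NumberField K] (ι : PadicAlgCl p ≃+* ℂ) (v vbar : IsDedekindDomain.HeightOneSpectrum (NumberField.RingOfIntegers K)) (κ₁ κ₂ : Literature.NumberTheory.EllipticCurves.ZpExtension K p) (γ₁ γ₂ : Field.absoluteGaloisGroup K) [Fact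 (Literature.NumberTheory.EllipticCurves.ZpExtension.IsTopGeneratorPair κ₁ κ₂ γ₁ γ₂)] [NeZero (NumberField.discr K).natAbs] (N : ℕ) [NeZero N] (f : CuspForm (CongruenceSubgroup.Gamma0 N) 2), Literature.NumberTheory.EllipticCurves.ModularForms.IsNewformOf W f → (N : ℤ) = W.conductorNorm ℤ → Literature.NumberTheory.EllipticCurves.IsImaginaryQuadratic K → ((Ideal.span {(p : ℤ)}).primesOver (NumberField.RingOfIntegers K)).ncard = 2 → ((p : ℕ) : NumberField.RingOfIntegers K) ∈ v.asIdeal → ((p : ℕ) : NumberField.RingOfIntegers K) ∈ vbar.asIdeal → vbar ≠ v → (∀ (w : NumberField.InfinitePlace K) (k : NumberField.RingOfIntegers K), k ∈ v.asIdeal ↔ ‖ι.symm (w.embedding (k : K))‖ < 1) → IsCoprime (N : ℤ) (NumberField.discr K) → (∀ ℓ : ℕ, ℓ.Prime → ℓ ∣ N → ((Ideal.span {(ℓ : ℤ)}).primesOver (NumberField.RingOfIntegers K)).ncard = 2) → Odd (NumberField.discr K) → NumberField.discr K ≠ -3 → κ₁.IsCyclotomic → κ₂.IsAnticyclotomic →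 ∀ (Ω δ : ℂ) (Ωp : (Literature.NumberTheory.EllipticCurves.unrIntegers p)ˣ) (LK G : PowerSeries (PowerSeries (PadicComplexInt p))), Ω ≠ 0 → (δ ^ 2 = (NumberField.discr K : ℂ) ∨ δ ^ 2 = -(NumberField.discr K : ℂ)) → Literature.NumberTheory.EllipticCurves.IsKatzMeasure₂ ι v vbar ∅ κ₁ κ₂ γ₁⁻¹ γ₂⁻¹ 1 Ω δ ((Ωp : Literature.NumberTheory.EllipticCurves.unrIntegers p) : PadicComplex p) LK → Literature.NumberTheory.EllipticCurves.IsGreenbergLFunctionAnyRoot₂ ι v vbar κ₁ κ₂ γ₁⁻¹ γ₂⁻¹ f (NumberField.discr K).natAbs (NumberField.classNumber K) LK G → ∃ (ΩK : ℂ) (Ωp' : (Literature.NumberTheory.EllipticCurves.unrIntegers p)ˣ) (L : Literature.NumberTheory.EllipticCurves.UnrSeries p), ΩK ≠ 0 ∧ Literature.NumberTheory.EllipticCurves.IsBDPLFunction ι v κ₂ γ₂ f ΩK ((Ωp' : Literature.NumberTheory.EllipticCurves.unrIntegers p) : PadicComplex p) L ∧ ∀ (J₀ : Literature.NumberTheory.EllipticCurves.unrIntegers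 p →+* PadicComplexInt p), (∀ x : Literature.NumberTheory.EllipticCurves.unrIntegers p, ((J₀ x : PadicComplexInt p) : PadicComplex p) = (x : PadicComplex p)) → Ideal.span {Literature.NumberTheory.EllipticCurves.UnrSeries₂.minus G} = Ideal.span {PowerSeries.map J₀ L} := by
  intro hIn hmodP W _ _ p _ hp hgood hord hs K _ _ ι v vbar κ₁ κ₂ γ₁ γ₂ _ _ N _ f hf hN hK hsplit hv hvbar hvv hι hcop hHeeg
    hodd hne3 hκ₁ hκ₂ Ω δ Ωp LK G hΩ hδ hLK hG
  have hset : GreenbergSetting ι W N K v vbar κ₁ κ₂ :=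
    ⟨hN, by omega, hord, hK, hsplit, hv, hvbar, hvv, hι, hcop, hodd, hne3, hκ₁, hκ₂⟩
  have hirr : (W.baseChange K).HasIrreducibleModPGaloisRep p :=
    Summit.BirchSwinnertonDyer.Rank1Residual.irrK_of_surj W p hs K hK.1
  obtain ⟨ΩK, Ωp', L, hΩK, hL, -⟩ := h422e ι W K v κ₂ γ₂ hf (by omega) hgood hK hHeeg hsplit hodd hne3 hirr hv hι hκ₂
    (isTopGenerator_of_pair (κ₁ := κ₁) (γ₁ := γ₁))
  exact ⟨ΩK, Ωp', L, hΩK, hL, fun J₀ hJ₀ ↦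
    h314 ι W K v vbar κ₁ κ₂ γ₁ γ₂ hf hset hHeeg Ω δ Ωp LK G hΩ hδ hLK hG ΩK Ωp' L hΩK hL J₀ hJ₀⟩

/-! ## §2 S1 at a good ordinary prime -/

/-- **S1 at a good ordinary prime, by name**: the text of `stub_bdpLowerHalfRatExists` with `GoodOrd W p` inserted follows from BCS25 Thm 1.2.4 (a)
(`thm124a_…`: a frame `L₀` and, along every compatible `j : ℤ_p → R₀`, `p^a·ch ⊆ p^b·(L₀)`), taken at `j = X11b.Halves.toUnr` and pushed along
`J₀` (`J = J₀ ∘ toUnr`). [cite: BurungaleCastellaSkinner2025, Thm. 1.2.4 (a) (arXiv:2405.00270v2 p. 3)] -/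
theorem bdpLowerHalfRatExists_of_goodOrd (h124a : thm124a_exists_isBDPLFunction_isTorsion_charIdeal_eq_rat) :
    SignedTwoVariableInputs → Literature.NumberTheory.EllipticCurves.ModularForms.nonempty_modularParametrizationData → ∀ (W : WeierstrassCurve ℚ) [W.IsElliptic] [W.IsGloballyMinimal] (p : ℕ) [Fact p.Prime], 5 ≤ p → W.HasGoodReductionAtPrime p → Literature.NumberTheory.EllipticCurves.Rank1Residual.GoodOrd W p → Literature.NumberTheory.EllipticCurves.Rank1Residual.Surj W p → ∀ (K : Type) [Field K] [NumberField K] (ι : PadicAlgCl p ≃+* ℂ) (v vbar : IsDedekindDomain.HeightOneSpectrum (NumberField.RingOfIntegers K)) (κ₁ κ₂ : Literature.NumberTheory.EllipticCurves.ZpExtension K p) (γ₁ γ₂ : Field.absoluteGaloisGroup K) [Fact (Literature.NumberTheory.EllipticCurves.ZpExtension.IsTopGeneratorPair κ₁ κ₂ γ₁ γ₂)] [NeZero (NumberField.discr K).natAbs] (N : ℕ) [NeZero N] (f : CuspForm (CongruenceSubgroup.Gamma0 N) 2), Literature.NumberTheory.EllipticCurves.ModularForms.IsNewformOf W f → (N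 : ℤ) = W.conductorNorm ℤ → Literature.NumberTheory.EllipticCurves.IsImaginaryQuadratic K → ((Ideal.span {(p : ℤ)}).primesOver (NumberField.RingOfIntegers K)).ncard = 2 → ((p : ℕ) : NumberField.RingOfIntegers K) ∈ v.asIdeal → ((p : ℕ) : NumberField.RingOfIntegers K) ∈ vbar.asIdeal → vbar ≠ v → (∀ (w : NumberField.InfinitePlace K) (k : NumberField.RingOfIntegers K), k ∈ v.asIdeal ↔ ‖ι.symm (w.embedding (k : K))‖ < 1) → IsCoprime (N : ℤ) (NumberField.discr K) → (∀ ℓ : ℕ, ℓ.Prime → ℓ ∣ N → ((Ideal.span {(ℓ : ℤ)}).primesOver (NumberField.RingOfIntegers K)).ncard = 2) → Odd (NumberField.discr K) → NumberField.discr K ≠ -3 → κ₁.IsCyclotomic → κ₂.IsAnticyclotomic → ∃ (ΩK : ℂ) (Ωp' : (Literature.NumberTheory.EllipticCurves.unrIntegers p)ˣ) (L : Literature.NumberTheory.EllipticCurves.UnrSeries p), ΩK ≠ 0 ∧ Literature.NumberTheory.EllipticCurves.IsBDPLFunction ι v κ₂ γ₂ f ΩK ((Ωp' : Literature.NumberTheory.EllipticCurves.unrIntegers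 p) : PadicComplex p) L ∧ ∀ J : ℤ_[p] →+* PadicComplexInt p, (∀ x : ℤ_[p], ((J x : PadicComplexInt p) : PadicComplex p) = ((x : ℚ_[p]) : PadicComplex p)) → ∀ (J₀ : Literature.NumberTheory.EllipticCurves.unrIntegers p →+* PadicComplexInt p), (∀ x : Literature.NumberTheory.EllipticCurves.unrIntegers p, ((J₀ x : PadicComplexInt p) : PadicComplex p) = (x : PadicComplex p)) → ∃ k : ℕ, ∀ y ∈ (haveI : Fact (κ₂.IsTopGenerator γ₂) := ⟨Literature.NumberTheory.EllipticCurves.YanZhu2026.isTopGenerator_of_pair (κ₁ := κ₁) (γ₁ := γ₁)⟩; Literature.NumberTheory.EllipticCurves.Castella2018.AcSelmer.XAc.charIdeal (W.baseChange K) p κ₂ vbar ∅ γ₂).map (PowerSeries.map J), PowerSeries.C (((p : ℕ) : PadicComplexInt p) ^ k) * y ∈ Ideal.span {PowerSeries.map J₀ L} := by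
  intro hIn hmodP W _ _ p _ hp hgood hord hs K _ _ ι v vbar κ₁ κ₂ γ₁ γ₂ _ _ N _ f hf hN hK hsplit hv hvbar hvv hι hcop hHeeg
    hodd hne3 hκ₁ hκ₂
  haveI hγ₂ : Fact (κ₂.IsTopGenerator γ₂) := ⟨isTopGenerator_of_pair (κ₁ := κ₁) (γ₁ := γ₁)⟩
  have hIrr : Rank1Residual.Irr W p := hasIrreducibleModPGaloisRep_of_hasSurjectiveModNGaloisRep W p hs
  obtain ⟨ΩK₀, Ωp₀, L₀, hΩK₀, hL₀, -, hj⟩ :=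
    h124a ι W K v vbar κ₂ γ₂ hf (by omega) hord hIrr hK hHeeg hsplit hodd hne3 hι hvbar hvv hκ₂
  refine ⟨ΩK₀, Ωp₀, L₀, hΩK₀, hL₀, fun J hJ J₀ hJ₀ ↦ ?_⟩
  obtain ⟨a, b, hab⟩ := hj (Summit.BirchSwinnertonDyer.Rank1Residual.X11b.Halves.toUnr p) (Summit.BirchSwinnertonDyer.Rank1Residual.X11b.Halves.coe_toUnr p)
  have hJeq : J = J₀.comp (Summit.BirchSwinnertonDyer.Rank1Residual.X11b.Halves.toUnr p) := by
    ext x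
    rw [hJ, RingHom.comp_apply, hJ₀, Summit.BirchSwinnertonDyer.Rank1Residual.X11b.Halves.coe_toUnr]
    rfl
  have hle : Ideal.span {PowerSeries.C ((p : unrIntegers p) ^ a)} *
      (Castella2018.AcSelmer.XAc.charIdeal (W.baseChange K) p κ₂ vbar ∅ γ₂).map
        (PowerSeries.map (Summit.BirchSwinnertonDyer.Rank1Residual.X11b.Halves.toUnr p)) ≤ Ideal.span {L₀} := by
    rw [hab]
    exact Ideal.mul_le_left
  have hle' := Ideal.map_mono (f := PowerSeries.map J₀) hle
  rw [Ideal.map_mul, Ideal.map_span, Set.image_singleton, Ideal.map_map, ← PowerSeries.map_comp, ← hJeq,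
    Ideal.map_span, Set.image_singleton, PowerSeries.map_C, map_pow, map_natCast] at hle'
  refine ⟨a, fun y hy ↦ ?_⟩
  exact hle' (Ideal.mul_mem_mul (Ideal.mem_span_singleton_self _) hy)

/-! ## §3 The ordinary slice of the crux, modulo S2 -/

/-- **The ORDINARY slice of the rational anticyclotomic crux, modulo the specialisation statement S2 only**: the crux's text (T11 shape) with
`GoodOrd W p` inserted follows from BCS25 Thm 1.2.4 (a), YZ26 Prop 3.14 (guarded), BCS25 Prop 4.2.2 and S2 (`stub_specializationRat`,
HOME/bsd-wall-sbc-p1/bdpline_stub_S2.txt) through the `bdpline` composition (§1, §2, X11b frame rigidity, `b = k₁ + k₂`).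
[cite: BurungaleCastellaSkinner2025, Thm. 1.2.4 (a) and Prop. 4.2.2 (arXiv:2405.00270v2)] [cite: YanZhu2024MainConjNonCM, Prop. 3.14] -/
theorem acDivRatChild_of_goodOrd_of_specialization
    (h124a : thm124a_exists_isBDPLFunction_isTorsion_charIdeal_eq_rat)
    (h314 : prop314_span_minus_eq_span_bdp_anyRoot_guarded) (h422e : prop422_exists_isBDPLFunction_mu_eq_zero)
    (hS2 : SignedTwoVariableInputs → Literature.NumberTheory.EllipticCurves.ModularForms.nonempty_modularParametrizationData → ∀ (W : WeierstrassCurve ℚ) [W.IsElliptic] [W.IsGloballyMinimal] (p : ℕ) [Fact p.Prime], 5 ≤ p → W.HasGoodReductionAtPrime p → Literature.NumberTheory.EllipticCurves.Rank1Residual.Surj W p → ∀ (K : Type) [Field K] [NumberField K] (ι : PadicAlgCl p ≃+* ℂ) (v vbar : IsDedekindDomain.HeightOneSpectrum (NumberField.RingOfIntegers K)) (κ₁ κ₂ : Literature.NumberTheory.EllipticCurves.ZpExtension K p) (γ₁ γ₂ : Field.absoluteGaloisGroup K) [Fact (Literature.NumberTheory.EllipticCurves.ZpExtension.IsTopGeneratorPair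 κ₁ κ₂ γ₁ γ₂)] [NeZero (NumberField.discr K).natAbs] (N : ℕ) [NeZero N] (f : CuspForm (CongruenceSubgroup.Gamma0 N) 2), Literature.NumberTheory.EllipticCurves.ModularForms.IsNewformOf W f → (N : ℤ) = W.conductorNorm ℤ → Literature.NumberTheory.EllipticCurves.IsImaginaryQuadratic K → ((Ideal.span {(p : ℤ)}).primesOver (NumberField.RingOfIntegers K)).ncard = 2 → ((p : ℕ) : NumberField.RingOfIntegers K) ∈ v.asIdeal → ((p : ℕ) : NumberField.RingOfIntegers K) ∈ vbar.asIdeal → vbar ≠ v → (∀ (w : NumberField.InfinitePlace K) (k : NumberField.RingOfIntegers K), k ∈ v.asIdeal ↔ ‖ι.symm (w.embedding (k : K))‖ < 1) → IsCoprime (N : ℤ) (NumberField.discr K) → (∀ ℓ : ℕ, ℓ.Prime → ℓ ∣ N → ((Ideal.span {(ℓ : ℤ)}).primesOver (NumberField.RingOfIntegers K)).ncard = 2) → Odd (NumberField.discr K) → NumberField.discr K ≠ -3 → κ₁.IsCyclotomic → κ₂.IsAnticyclotomic → ∀ J : ℤ_[p] →+* PadicComplexInt p, (∀ x : ℤ_[p],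 ((J x : PadicComplexInt p) : PadicComplex p) = ((x : ℚ_[p]) : PadicComplex p)) → Module.IsTorsion (Literature.NumberTheory.EllipticCurves.IwasawaAlgebra₂ p) ((W.baseChange K).XGr₂ p κ₁ κ₂ vbar γ₁ γ₂) → ∃ k : ℕ, ∀ x ∈ ((WeierstrassCurve.XGr₂.charIdeal (W.baseChange K) p κ₁ κ₂ vbar γ₁ γ₂).map (Literature.NumberTheory.EllipticCurves.IwasawaAlgebra₂.toUnr₂ p J)).map (PowerSeries.constantCoeff (R := PowerSeries (PadicComplexInt p))), PowerSeries.C (((p : ℕ) : PadicComplexInt p) ^ k) * x ∈ (haveI : Fact (κ₂.IsTopGenerator γ₂) := ⟨Literature.NumberTheory.EllipticCurves.YanZhu2026.isTopGenerator_of_pair (κ₁ := κ₁) (γ₁ := γ₁)⟩; Literature.NumberTheory.EllipticCurves.Castella2018.AcSelmer.XAc.charIdeal (W.baseChange K) p κ₂ vbar ∅ γ₂).map (PowerSeries.map J)) :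
    SignedTwoVariableInputs → Literature.NumberTheory.EllipticCurves.ModularForms.nonempty_modularParametrizationData → ∀ (W : WeierstrassCurve ℚ) [W.IsElliptic] [W.IsGloballyMinimal] (p : ℕ) [Fact p.Prime], 5 ≤ p → W.HasGoodReductionAtPrime p → Literature.NumberTheory.EllipticCurves.Rank1Residual.GoodOrd W p → Literature.NumberTheory.EllipticCurves.Rank1Residual.Surj W p → ∀ (K : Type) [Field K] [NumberField K] (ι : PadicAlgCl p ≃+* ℂ) (v vbar : IsDedekindDomain.HeightOneSpectrum (NumberField.RingOfIntegers K)) (κ₁ κ₂ : Literature.NumberTheory.EllipticCurves.ZpExtension K p) (γ₁ γ₂ : Field.absoluteGaloisGroup K) [Fact (Literature.NumberTheory.EllipticCurves.ZpExtension.IsTopGeneratorPair κ₁ κ₂ γ₁ γ₂)] [NeZero (NumberField.discr K).natAbs] (N : ℕ) [NeZero N] (f : CuspForm (CongruenceSubgroup.Gamma0 N) 2), Literature.NumberTheory.EllipticCurves.ModularForms.IsNewformOf W f → (N : ℤ) = W.conductorNorm ℤ → Literature.NumberTheory.EllipticCurves.IsImaginaryQuadratic K → ((Ideal.span {(p : ℤ)}).primesOver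 (NumberField.RingOfIntegers K)).ncard = 2 → ((p : ℕ) : NumberField.RingOfIntegers K) ∈ v.asIdeal → ((p : ℕ) : NumberField.RingOfIntegers K) ∈ vbar.asIdeal → vbar ≠ v → (∀ (w : NumberField.InfinitePlace K) (k : NumberField.RingOfIntegers K), k ∈ v.asIdeal ↔ ‖ι.symm (w.embedding (k : K))‖ < 1) → IsCoprime (N : ℤ) (NumberField.discr K) → (∀ ℓ : ℕ, ℓ.Prime → ℓ ∣ N → ((Ideal.span {(ℓ : ℤ)}).primesOver (NumberField.RingOfIntegers K)).ncard = 2) → Odd (NumberField.discr K) → NumberField.discr K ≠ -3 → κ₁.IsCyclotomic → κ₂.IsAnticyclotomic → ∀ (Ω δ : ℂ) (Ωp : (Literature.NumberTheory.EllipticCurves.unrIntegers p)ˣ) (LK G : PowerSeries (PowerSeries (PadicComplexInt p))), Ω ≠ 0 → (δ ^ 2 = (NumberField.discr K : ℂ) ∨ δ ^ 2 = -(NumberField.discr K : ℂ)) → Literature.NumberTheory.EllipticCurves.IsKatzMeasure₂ ι v vbar ∅ κ₁ κ₂ γ₁⁻¹ γ₂⁻¹ 1 Ω δ ((Ωp :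 Literature.NumberTheory.EllipticCurves.unrIntegers p) : PadicComplex p) LK → Literature.NumberTheory.EllipticCurves.IsGreenbergLFunctionAnyRoot₂ ι v vbar κ₁ κ₂ γ₁⁻¹ γ₂⁻¹ f (NumberField.discr K).natAbs (NumberField.classNumber K) LK G → ∀ J : ℤ_[p] →+* PadicComplexInt p, (∀ x : ℤ_[p], ((J x : PadicComplexInt p) : PadicComplex p) = ((x : ℚ_[p]) : PadicComplex p)) → Module.IsTorsion (Literature.NumberTheory.EllipticCurves.IwasawaAlgebra₂ p) ((W.baseChange K).XGr₂ p κ₁ κ₂ vbar γ₁ γ₂) → ∃ b : ℕ, ∀ x ∈ ((WeierstrassCurve.XGr₂.charIdeal (W.baseChange K) p κ₁ κ₂ vbar γ₁ γ₂).map (Literature.NumberTheory.EllipticCurves.IwasawaAlgebra₂.toUnr₂ p J)).map (PowerSeries.constantCoeff (R := PowerSeries (PadicComplexInt p))), PowerSeries.C (((p : ℕ) : PadicComplexInt p) ^ b) * x ∈ Ideal.span {Literature.NumberTheory.EllipticCurves.UnrSeries₂.minus G} := by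
  intro hIn hmodP W _ _ p _ hp hgood hord hs K _ _ ι v vbar κ₁ κ₂ γ₁ γ₂ _ _ N _ f hf hN hK hsplit hv hvbar hvv hι hcop hHeeg
    hodd hne3 hκ₁ hκ₂ Ω δ Ωp LK G hΩ hδ hLK hG J hJ htors
  have hp2 : p ≠ 2 := by omega
  have hγ₂ : κ₂.IsTopGenerator γ₂ := isTopGenerator_of_pair (κ₁ := κ₁) (γ₁ := γ₁)
  obtain ⟨ΩK₃, Ωp₃, L₃, hΩK₃, hL₃, hcmp⟩ :=
    minusIsBDP_of_goodOrd h314 h422e hIn hmodP W p hp hgood hord hs K ι v vbar κ₁ κ₂ γ₁ γ₂ N f hf hN hK hsplit hv hvbar hvv hι hcop hHeeg hodd hne3 hκ₁ hκ₂ Ω δ Ωp LK G hΩ hδ hLK hG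
  obtain ⟨ΩK₁, Ωp₁, L₁, hΩK₁, hL₁, hS1⟩ := bdpLowerHalfRatExists_of_goodOrd h124a hIn hmodP W p hp hgood hord hs K ι v vbar κ₁ κ₂ γ₁ γ₂ N f hf hN hK hsplit hv hvbar hvv hι hcop hHeeg hodd hne3 hκ₁ hκ₂
  let J₀ : unrIntegers p →+* PadicComplexInt p := Summit.BirchSwinnertonDyer.Rank1Residual.X11b.R1.unrToCpInt p
  have hJ₀ : ∀ x : unrIntegers p, ((J₀ x : PadicComplexInt p) : PadicComplex p) = (x : PadicComplex p) :=
    Summit.BirchSwinnertonDyer.Rank1Residual.X11b.R1.coe_unrToCpInt p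
  obtain ⟨k₂, hk₂⟩ := hS2 hIn hmodP W p hp hgood hs K ι v vbar κ₁ κ₂ γ₁ γ₂ N f hf hN hK hsplit hv hvbar hvv hι hcop hHeeg hodd hne3 hκ₁ hκ₂ J hJ htors
  obtain ⟨k₁, hk₁⟩ := hS1 J hJ J₀ hJ₀
  obtain ⟨U, hU, hUL⟩ := Summit.BirchSwinnertonDyer.Rank1Residual.X11b.R1.exists_unit_mul_eq_of_isBDPLFunctionInt hp2 hK hκ₂ hγ₂ hΩK₁ hΩK₃
    (Summit.BirchSwinnertonDyer.Rank1Residual.X11b.coe_units_unrIntegers_ne_zero Ωp₁) (Summit.BirchSwinnertonDyer.Rank1Residual.X11b.coe_units_unrIntegers_ne_zero Ωp₃)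
    (Summit.BirchSwinnertonDyer.Rank1Residual.X11b.R1.isBDPLFunctionInt_map hL₁) (Summit.BirchSwinnertonDyer.Rank1Residual.X11b.R1.isBDPLFunctionInt_map hL₃)
  have hspan : Ideal.span {PowerSeries.map J₀ L₃} = Ideal.span {PowerSeries.map J₀ L₁} := by
    show Ideal.span {PowerSeries.map (Summit.BirchSwinnertonDyer.Rank1Residual.X11b.R1.unrToCpInt p) L₃} = _
    rw [hUL]
    exact Ideal.span_singleton_mul_left_unit hU _
  refine ⟨k₁ + k₂, fun x hx ↦ ?_⟩
  rw [hcmp J₀ hJ₀, hspan, pow_add, map_mul, mul_assoc]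
  exact hk₁ _ (hk₂ x hx)


/-! ## §4 Integral twins (for the live integral child `AnticyclotomicEisensteinDivisibility`, stmt-…-20576, and line `bdpline` in integral form) -/

/-- **Integral S1 at a good ordinary prime, by name**: the text of `stub_bdpLowerHalfExists` (integral ∃-frame lower half, `Surj`) with
`GoodOrd W p` inserted, from BCS25 Thm 1.2.4 (b) (`thm124b_…`, equality along every compatible `j : ℤ_p → R₀`) at `j = X11b.Halves.toUnr`,
pushed along `J₀`. [cite: BurungaleCastellaSkinner2025, Thm. 1.2.4 (b) (arXiv:2405.00270v2 p. 3)] -/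
theorem bdpLowerHalfExists_of_goodOrd (h124b : thm124b_exists_isBDPLFunction_isTorsion_charIdeal_eq) :
    SignedTwoVariableInputs → Literature.NumberTheory.EllipticCurves.ModularForms.nonempty_modularParametrizationData → ∀ (W : WeierstrassCurve ℚ) [W.IsElliptic] [W.IsGloballyMinimal] (p : ℕ) [Fact p.Prime], 5 ≤ p → W.HasGoodReductionAtPrime p → Literature.NumberTheory.EllipticCurves.Rank1Residual.GoodOrd W p → Literature.NumberTheory.EllipticCurves.Rank1Residual.Surj W p → ∀ (K : Type) [Field K] [NumberField K] (ι : PadicAlgCl p ≃+* ℂ) (v vbar : IsDedekindDomain.HeightOneSpectrum (NumberField.RingOfIntegers K)) (κ₁ κ₂ : Literature.NumberTheory.EllipticCurves.ZpExtension K p) (γ₁ γ₂ : Field.absoluteGaloisGroup K) [Fact (Literature.NumberTheory.EllipticCurves.ZpExtension.IsTopGeneratorPair κ₁ κ₂ γ₁ γ₂)] [NeZero (NumberField.discr K).natAbs] (N : ℕ) [NeZero N] (f : CuspForm (CongruenceSubgroup.Gamma0 N) 2), Literature.NumberTheory.EllipticCurves.ModularForms.IsNewformOf W f → (N : ℤ)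 = W.conductorNorm ℤ → Literature.NumberTheory.EllipticCurves.IsImaginaryQuadratic K → ((Ideal.span {(p : ℤ)}).primesOver (NumberField.RingOfIntegers K)).ncard = 2 → ((p : ℕ) : NumberField.RingOfIntegers K) ∈ v.asIdeal → ((p : ℕ) : NumberField.RingOfIntegers K) ∈ vbar.asIdeal → vbar ≠ v → (∀ (w : NumberField.InfinitePlace K) (k : NumberField.RingOfIntegers K), k ∈ v.asIdeal ↔ ‖ι.symm (w.embedding (k : K))‖ < 1) → IsCoprime (N : ℤ) (NumberField.discr K) → (∀ ℓ : ℕ, ℓ.Prime → ℓ ∣ N → ((Ideal.span {(ℓ : ℤ)}).primesOver (NumberField.RingOfIntegers K)).ncard = 2) → Odd (NumberField.discr K) → NumberField.discr K ≠ -3 → κ₁.IsCyclotomic → κ₂.IsAnticyclotomic → ∃ (ΩK : ℂ) (Ωp' : (Literature.NumberTheory.EllipticCurves.unrIntegers p)ˣ) (L : Literature.NumberTheory.EllipticCurves.UnrSeries p), ΩK ≠ 0 ∧ Literature.NumberTheory.EllipticCurves.IsBDPLFunction ι v κ₂ γ₂ f ΩK ((Ωp' : Literature.NumberTheory.EllipticCurves.unrIntegers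 p) : PadicComplex p) L ∧ ∀ J : ℤ_[p] →+* PadicComplexInt p, (∀ x : ℤ_[p], ((J x : PadicComplexInt p) : PadicComplex p) = ((x : ℚ_[p]) : PadicComplex p)) → ∀ (J₀ : Literature.NumberTheory.EllipticCurves.unrIntegers p →+* PadicComplexInt p), (∀ x : Literature.NumberTheory.EllipticCurves.unrIntegers p, ((J₀ x : PadicComplexInt p) : PadicComplex p) = (x : PadicComplex p)) → (haveI : Fact (κ₂.IsTopGenerator γ₂) := ⟨Literature.NumberTheory.EllipticCurves.YanZhu2026.isTopGenerator_of_pair (κ₁ := κ₁) (γ₁ := γ₁)⟩; Literature.NumberTheory.EllipticCurves.Castella2018.AcSelmer.XAc.charIdeal (W.baseChange K) p κ₂ vbar ∅ γ₂).map (PowerSeries.map J) ≤ Ideal.span {PowerSeries.map J₀ L} := by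
  intro hIn hmodP W _ _ p _ hp hgood hord hs K _ _ ι v vbar κ₁ κ₂ γ₁ γ₂ _ _ N _ f hf hN hK hsplit hv hvbar hvv hι hcop hHeeg
    hodd hne3 hκ₁ hκ₂
  haveI hγ₂ : Fact (κ₂.IsTopGenerator γ₂) := ⟨isTopGenerator_of_pair (κ₁ := κ₁) (γ₁ := γ₁)⟩
  obtain ⟨ΩK₀, Ωp₀, L₀, hΩK₀, hL₀, -, hj⟩ :=
    h124b ι W K v vbar κ₂ γ₂ hf (by omega) hord hs hK hHeeg hsplit hodd hne3 hι hvbar hvv hκ₂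
  refine ⟨ΩK₀, Ωp₀, L₀, hΩK₀, hL₀, fun J hJ J₀ hJ₀ ↦ ?_⟩
  have hab := hj (Summit.BirchSwinnertonDyer.Rank1Residual.X11b.Halves.toUnr p) (Summit.BirchSwinnertonDyer.Rank1Residual.X11b.Halves.coe_toUnr p)
  have hJeq : J = J₀.comp (Summit.BirchSwinnertonDyer.Rank1Residual.X11b.Halves.toUnr p) := by
    ext x
    rw [hJ, RingHom.comp_apply, hJ₀, Summit.BirchSwinnertonDyer.Rank1Residual.X11b.Halves.coe_toUnr]
    rfl
  have hle' := Ideal.map_mono (f := PowerSeries.map J₀) hab.le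
  rw [Ideal.map_map, ← PowerSeries.map_comp, ← hJeq, Ideal.map_span, Set.image_singleton] at hle'
  exact hle'

/-- **The ORDINARY slice of the INTEGRAL anticyclotomic crux (stmt-…-20576), modulo the specialisation statement and Λ_K-torsion of
`X_Gr₂`**: the crux's text (`SignedTwoVariableInputs →` registered `stub_acDiv`) with `GoodOrd W p` inserted follows from BCS25 Thm 1.2.4 (b),
YZ26 Prop 3.14 (guarded), BCS25 Prop 4.2.2, the integral specialisation statement S2 (`stub_specialization`, HOME/bsd-wall-sbc-p1/
bdpline_stub_S2i.txt) and the torsion statement S0 (`stub_xGr₂_isTorsion`, bdpline_stub_S0i.txt), through the integral `bdpline` composition.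
[cite: BurungaleCastellaSkinner2025, Thm. 1.2.4 (b) and Prop. 4.2.2 (arXiv:2405.00270v2)] [cite: YanZhu2024MainConjNonCM, Prop. 3.14] -/
theorem acDivChild_of_goodOrd_of_specialization_of_torsion
    (h124b : thm124b_exists_isBDPLFunction_isTorsion_charIdeal_eq)
    (h314 : prop314_span_minus_eq_span_bdp_anyRoot_guarded) (h422e : prop422_exists_isBDPLFunction_mu_eq_zero)
    (hS2 : SignedTwoVariableInputs → Literature.NumberTheory.EllipticCurves.ModularForms.nonempty_modularParametrizationData → ∀ (W : WeierstrassCurve ℚ) [W.IsElliptic] [W.IsGloballyMinimal] (p : ℕ) [Fact p.Prime], 5 ≤ p → W.HasGoodReductionAtPrime p → Literature.NumberTheory.EllipticCurves.Rank1Residual.Surj W p → ∀ (K : Type) [Field K] [NumberField K] (ι : PadicAlgCl p ≃+* ℂ) (v vbar : IsDedekindDomain.HeightOneSpectrum (NumberField.RingOfIntegers K)) (κ₁ κ₂ : Literature.NumberTheory.EllipticCurves.ZpExtension K p) (γ₁ γ₂ : Field.absoluteGaloisGroup K) [Fact (Literature.NumberTheory.EllipticCurves.ZpExtension.IsTopGeneratorPair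 κ₁ κ₂ γ₁ γ₂)] [NeZero (NumberField.discr K).natAbs] (N : ℕ) [NeZero N] (f : CuspForm (CongruenceSubgroup.Gamma0 N) 2), Literature.NumberTheory.EllipticCurves.ModularForms.IsNewformOf W f → (N : ℤ) = W.conductorNorm ℤ → Literature.NumberTheory.EllipticCurves.IsImaginaryQuadratic K → ((Ideal.span {(p : ℤ)}).primesOver (NumberField.RingOfIntegers K)).ncard = 2 → ((p : ℕ) : NumberField.RingOfIntegers K) ∈ v.asIdeal → ((p : ℕ) : NumberField.RingOfIntegers K) ∈ vbar.asIdeal → vbar ≠ v → (∀ (w : NumberField.InfinitePlace K) (k : NumberField.RingOfIntegers K), k ∈ v.asIdeal ↔ ‖ι.symm (w.embedding (k : K))‖ < 1) → IsCoprime (N : ℤ) (NumberField.discr K) → (∀ ℓ : ℕ, ℓ.Prime → ℓ ∣ N → ((Ideal.span {(ℓ : ℤ)}).primesOver (NumberField.RingOfIntegers K)).ncard = 2) → Odd (NumberField.discr K) → NumberField.discr K ≠ -3 → κ₁.IsCyclotomic → κ₂.IsAnticyclotomic → ∀ J : ℤ_[p] →+* PadicComplexInt p, (∀ x : ℤ_[p],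 ((J x : PadicComplexInt p) : PadicComplex p) = ((x : ℚ_[p]) : PadicComplex p)) → Module.IsTorsion (Literature.NumberTheory.EllipticCurves.IwasawaAlgebra₂ p) ((W.baseChange K).XGr₂ p κ₁ κ₂ vbar γ₁ γ₂) → ((WeierstrassCurve.XGr₂.charIdeal (W.baseChange K) p κ₁ κ₂ vbar γ₁ γ₂).map (Literature.NumberTheory.EllipticCurves.IwasawaAlgebra₂.toUnr₂ p J)).map (PowerSeries.constantCoeff (R := PowerSeries (PadicComplexInt p))) ≤ (haveI : Fact (κ₂.IsTopGenerator γ₂) := ⟨Literature.NumberTheory.EllipticCurves.YanZhu2026.isTopGenerator_of_pair (κ₁ := κ₁) (γ₁ := γ₁)⟩; Literature.NumberTheory.EllipticCurves.Castella2018.AcSelmer.XAc.charIdeal (W.baseChange K) p κ₂ vbar ∅ γ₂).map (PowerSeries.map J))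
    (hS0 : SignedTwoVariableInputs → Literature.NumberTheory.EllipticCurves.ModularForms.nonempty_modularParametrizationData → ∀ (W : WeierstrassCurve ℚ) [W.IsElliptic] [W.IsGloballyMinimal] (p : ℕ) [Fact p.Prime], 5 ≤ p → W.HasGoodReductionAtPrime p → Literature.NumberTheory.EllipticCurves.Rank1Residual.Surj W p → ∀ (K : Type) [Field K] [NumberField K] (ι : PadicAlgCl p ≃+* ℂ) (v vbar : IsDedekindDomain.HeightOneSpectrum (NumberField.RingOfIntegers K)) (κ₁ κ₂ : Literature.NumberTheory.EllipticCurves.ZpExtension K p) (γ₁ γ₂ : Field.absoluteGaloisGroup K) [Fact (Literature.NumberTheory.EllipticCurves.ZpExtension.IsTopGeneratorPair κ₁ κ₂ γ₁ γ₂)] [NeZero (NumberField.discr K).natAbs] (N : ℕ) [NeZero N] (f : CuspForm (CongruenceSubgroup.Gamma0 N) 2), Literature.NumberTheory.EllipticCurves.ModularForms.IsNewformOf W f → (N : ℤ) = W.conductorNorm ℤ → Literature.NumberTheory.EllipticCurves.IsImaginaryQuadratic K → ((Ideal.span {(p : ℤ)}).primesOver (NumberField.RingOfIntegers K)).ncard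 = 2 → ((p : ℕ) : NumberField.RingOfIntegers K) ∈ v.asIdeal → ((p : ℕ) : NumberField.RingOfIntegers K) ∈ vbar.asIdeal → vbar ≠ v → (∀ (w : NumberField.InfinitePlace K) (k : NumberField.RingOfIntegers K), k ∈ v.asIdeal ↔ ‖ι.symm (w.embedding (k : K))‖ < 1) → IsCoprime (N : ℤ) (NumberField.discr K) → (∀ ℓ : ℕ, ℓ.Prime → ℓ ∣ N → ((Ideal.span {(ℓ : ℤ)}).primesOver (NumberField.RingOfIntegers K)).ncard = 2) → Odd (NumberField.discr K) → NumberField.discr K ≠ -3 → κ₁.IsCyclotomic → κ₂.IsAnticyclotomic → Module.IsTorsion (Literature.NumberTheory.EllipticCurves.IwasawaAlgebra₂ p) ((W.baseChange K).XGr₂ p κ₁ κ₂ vbar γ₁ γ₂)) :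
    SignedTwoVariableInputs → Literature.NumberTheory.EllipticCurves.ModularForms.nonempty_modularParametrizationData → ∀ (W : WeierstrassCurve ℚ) [W.IsElliptic] [W.IsGloballyMinimal] (p : ℕ) [Fact p.Prime], 5 ≤ p → W.HasGoodReductionAtPrime p → Literature.NumberTheory.EllipticCurves.Rank1Residual.GoodOrd W p → Literature.NumberTheory.EllipticCurves.Rank1Residual.Surj W p → ∀ (K : Type) [Field K] [NumberField K] (ι : PadicAlgCl p ≃+* ℂ) (v vbar : IsDedekindDomain.HeightOneSpectrum (NumberField.RingOfIntegers K)) (κ₁ κ₂ : Literature.NumberTheory.EllipticCurves.ZpExtension K p) (γ₁ γ₂ : Field.absoluteGaloisGroup K) [Fact (Literature.NumberTheory.EllipticCurves.ZpExtension.IsTopGeneratorPair κ₁ κ₂ γ₁ γ₂)] [NeZero (NumberField.discr K).natAbs] (N : ℕ) [NeZero N] (f : CuspForm (CongruenceSubgroup.Gamma0 N) 2), Literature.NumberTheory.EllipticCurves.ModularForms.IsNewformOf W f → (N : ℤ) = W.conductorNorm ℤ → Literature.NumberTheory.EllipticCurves.IsImaginaryQuadratic K → ((Ideal.span {(p : ℤ)}).primesOver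 (NumberField.RingOfIntegers K)).ncard = 2 → ((p : ℕ) : NumberField.RingOfIntegers K) ∈ v.asIdeal → ((p : ℕ) : NumberField.RingOfIntegers K) ∈ vbar.asIdeal → vbar ≠ v → (∀ (w : NumberField.InfinitePlace K) (k : NumberField.RingOfIntegers K), k ∈ v.asIdeal ↔ ‖ι.symm (w.embedding (k : K))‖ < 1) → IsCoprime (N : ℤ) (NumberField.discr K) → (∀ ℓ : ℕ, ℓ.Prime → ℓ ∣ N → ((Ideal.span {(ℓ : ℤ)}).primesOver (NumberField.RingOfIntegers K)).ncard = 2) → Odd (NumberField.discr K) → NumberField.discr K ≠ -3 → κ₁.IsCyclotomic → κ₂.IsAnticyclotomic → ∀ (Ω δ : ℂ) (Ωp : (Literature.NumberTheory.EllipticCurves.unrIntegers p)ˣ) (LK G : PowerSeries (PowerSeries (PadicComplexInt p))), Ω ≠ 0 → (δ ^ 2 = (NumberField.discr K : ℂ) ∨ δ ^ 2 = -(NumberField.discr K : ℂ)) → Literature.NumberTheory.EllipticCurves.IsKatzMeasure₂ ι v vbar ∅ κ₁ κ₂ γ₁⁻¹ γ₂⁻¹ 1 Ω δ ((Ωp :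 Literature.NumberTheory.EllipticCurves.unrIntegers p) : PadicComplex p) LK → Literature.NumberTheory.EllipticCurves.IsGreenbergLFunctionAnyRoot₂ ι v vbar κ₁ κ₂ γ₁⁻¹ γ₂⁻¹ f (NumberField.discr K).natAbs (NumberField.classNumber K) LK G → ∀ J : ℤ_[p] →+* PadicComplexInt p, (∀ x : ℤ_[p], ((J x : PadicComplexInt p) : PadicComplex p) = ((x : ℚ_[p]) : PadicComplex p)) → ((WeierstrassCurve.XGr₂.charIdeal (W.baseChange K) p κ₁ κ₂ vbar γ₁ γ₂).map (Literature.NumberTheory.EllipticCurves.IwasawaAlgebra₂.toUnr₂ p J)).map (PowerSeries.constantCoeff (R := PowerSeries (PadicComplexInt p))) ≤ Ideal.span {Literature.NumberTheory.EllipticCurves.UnrSeries₂.minus G} := by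
  intro hIn hmodP W _ _ p _ hp hgood hord hs K _ _ ι v vbar κ₁ κ₂ γ₁ γ₂ _ _ N _ f hf hN hK hsplit hv hvbar hvv hι hcop hHeeg
    hodd hne3 hκ₁ hκ₂ Ω δ Ωp LK G hΩ hδ hLK hG J hJ
  have hp2 : p ≠ 2 := by omega
  have hγ₂ : κ₂.IsTopGenerator γ₂ := isTopGenerator_of_pair (κ₁ := κ₁) (γ₁ := γ₁)
  have htors := hS0 hIn hmodP W p hp hgood hs K ι v vbar κ₁ κ₂ γ₁ γ₂ N f hf hN hK hsplit hv hvbar hvv hι hcop hHeeg hodd hne3 hκ₁ hκ₂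
  obtain ⟨ΩK₃, Ωp₃, L₃, hΩK₃, hL₃, hcmp⟩ :=
    minusIsBDP_of_goodOrd h314 h422e hIn hmodP W p hp hgood hord hs K ι v vbar κ₁ κ₂ γ₁ γ₂ N f hf hN hK hsplit hv hvbar hvv hι hcop hHeeg hodd hne3 hκ₁ hκ₂ Ω δ Ωp LK G hΩ hδ hLK hG
  obtain ⟨ΩK₁, Ωp₁, L₁, hΩK₁, hL₁, hS1⟩ := bdpLowerHalfExists_of_goodOrd h124b hIn hmodP W p hp hgood hord hs K ι v vbar κ₁ κ₂ γ₁ γ₂ N f hf hN hK hsplit hv hvbar hvv hι hcop hHeeg hodd hne3 hκ₁ hκ₂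
  let J₀ : unrIntegers p →+* PadicComplexInt p := Summit.BirchSwinnertonDyer.Rank1Residual.X11b.R1.unrToCpInt p
  have hJ₀ : ∀ x : unrIntegers p, ((J₀ x : PadicComplexInt p) : PadicComplex p) = (x : PadicComplex p) :=
    Summit.BirchSwinnertonDyer.Rank1Residual.X11b.R1.coe_unrToCpInt p
  have h2 := hS2 hIn hmodP W p hp hgood hs K ι v vbar κ₁ κ₂ γ₁ γ₂ N f hf hN hK hsplit hv hvbar hvv hι hcop hHeeg hodd hne3 hκ₁ hκ₂ J hJ htors
  have h1 := hS1 J hJ J₀ hJ₀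
  obtain ⟨U, hU, hUL⟩ := Summit.BirchSwinnertonDyer.Rank1Residual.X11b.R1.exists_unit_mul_eq_of_isBDPLFunctionInt hp2 hK hκ₂ hγ₂ hΩK₁ hΩK₃
    (Summit.BirchSwinnertonDyer.Rank1Residual.X11b.coe_units_unrIntegers_ne_zero Ωp₁) (Summit.BirchSwinnertonDyer.Rank1Residual.X11b.coe_units_unrIntegers_ne_zero Ωp₃)
    (Summit.BirchSwinnertonDyer.Rank1Residual.X11b.R1.isBDPLFunctionInt_map hL₁) (Summit.BirchSwinnertonDyer.Rank1Residual.X11b.R1.isBDPLFunctionInt_map hL₃)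
  have hspan : Ideal.span {PowerSeries.map J₀ L₃} = Ideal.span {PowerSeries.map J₀ L₁} := by
    show Ideal.span {PowerSeries.map (Summit.BirchSwinnertonDyer.Rank1Residual.X11b.R1.unrToCpInt p) L₃} = _
    rw [hUL]
    exact Ideal.span_singleton_mul_left_unit hU _
  rw [hcmp J₀ hJ₀, hspan]
  exact h2.trans h1

end Summit.BirchSwinnertonDyer.BirchSwinnertonDyer.Theorems.SignedBaseChangeBdplineRungs

end
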